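import Mathlib
import HarnessLib

/-!
# Stickelberger's theorem via Jacobi sums, I: the Gauss sum of a character of order `p`

Let `p` be an odd prime, `K` a `p`-th cyclotomic field (`IsCyclotomicExtension {p} ℚ K`),
`G = Gal(K/ℚ) = {σ_a}` (`σ_a ζ_p = ζ_p^a`, `Stickelberger.gal`), and `l ≡ 1 (mod p)` a prime. For a
character `χ : (ℤ/lℤ)ˣ → μ_p ⊂ 𝓞 K` of order `p` (these exist, Mathlib's
`MulChar.exists_mulChar_orderOf`) we consider, following [Schoof2009, Chapter 9, proof of
Theorem 9.5] and [Schoof2009, Exercise 9.6], the Gauss sum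
`τ(χ) = ∑_x χ(x) ζ_l^x` (`Stickelberger.tau`) in the ring of integers of `M = K(ζ_l)`
(`CyclotomicField l K`), and the following elements of `𝓞 K`:

* `Stickelberger.jacProd χ b = ∏_{1 ≤ j < b} J(χ, χ^j)` (products of Jacobi sums), and
* `Stickelberger.gElt χ = χ(-1) · l · ∏_{1 ≤ j ≤ p-2} J(χ, χ^j)`, which is `τ(χ)^p`
  (`Stickelberger.tau_pow_orderOf`, Mathlib's `gaussSum_pow_eq_prod_jacobiSum`).

Schoof proves [Schoof2009, Theorem 9.5] (for a prime `𝔩 ∣ l` of degree one, `𝔩^θ` is principal for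
`θ` in the Stickelberger ideal) by Kummer theory (`σ_b(τ^p) = τ^{pb}·(p-th power)`, Exercise 9.9)
and a ramification argument (Exercise 9.8). We replace both by the classical Jacobi-sum identities
(closer to Kummer's original 1847 argument), all transported to `𝓞 K` by the injectivity of
`𝓞 K → 𝓞 M`:

* `Stickelberger.gElt_pow` — `g(χ)^b = g(χ^b) · D_b(χ)^p` for `0 < b < p`
  (`τ(χ)^b = τ(χ^b) D_b(χ)`, Mathlib's `gaussSum_pow_eq_prod_jacobiSum_aux`); with
  `Stickelberger.gal_smul_gElt` — `σ_a g(χ) = g(χ^a)` — this is the substitute for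
  "`σ_b(τ^p) = τ^{pb} · (p`th power`)`" of [Schoof2009, p. 63];
* `Stickelberger.gElt_mul_gElt_inv` — `g(χ) g(χ⁻¹) = l^p` ([Schoof2009, Exercise 9.6 (a)]:
  `τ τ̄ = l`);
* `Stickelberger.gElt_mem` — `g(χ)` lies in *every* prime of `𝓞 K` above `l`: indeed
  `τ(χ) = ∑ χ(x)(ζ_l^x - 1) ∈ (ζ_l - 1) 𝓞 M` and `ζ_l - 1` lies in every prime above `l`; this
  replaces the ramification argument "`x_1 ≢ 0 (mod p)`" of [Schoof2009, p. 64].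

The factorisation of `(g(χ))` and Theorem 9.5 itself are in `StickelbergerTheorem`. Everything here
is proved; the definitions are the explicit elements above and the auxiliary data `M, ξ, ψ, toM, τ`.
-/

open NumberField IsCyclotomicExtension Finset Polynomial
open scoped Pointwise

namespace Literature.NumberTheory.NumberFields

namespace Stickelberger

variable {p : ℕ} [hp : Fact p.Prime] {K : Type*} [Field K] [NumberField K]
  [hK : IsCyclotomicExtension {p} ℚ K]
variable {l : ℕ} [hl : Fact l.Prime]

variable (p K) in
/-- `σ_a ∈ Gal(K/ℚ)`: the automorphism with `σ_a ζ = ζ^a` for every `p`-th root of unity `ζ`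
(the inverse of Mathlib's `IsCyclotomicExtension.Rat.galEquivZMod`). [cite: Schoof2009, Ch. 9 (p. 58)] -/
noncomputable def gal (a : (ZMod p)ˣ) : Gal(K/ℚ) := (Rat.galEquivZMod p K).symm a

/-- `σ_a x = x^a` for `x ∈ 𝓞 K` with `x^p = 1`. [cite: Schoof2009, Ch. 9 (p. 58)] -/
theorem gal_smul_of_pow_eq (a : (ZMod p)ˣ) {x : 𝓞 K} (hx : x ^ p = 1) :
    gal p K a • x = x ^ (a : ZMod p).val := by
  rw [Rat.galEquivZMod_smul_of_pow_eq p K (gal p K a) hx, gal, MulEquiv.apply_symm_apply]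

/-- `σ_{ab} = σ_a σ_b`. [folklore] -/
theorem gal_mul (a b : (ZMod p)ˣ) : gal p K (a * b) = gal p K a * gal p K b :=
  map_mul (Rat.galEquivZMod p K).symm a b

/-- `σ_1 = 1`. [folklore] -/
theorem gal_one : gal p K 1 = 1 := map_one (Rat.galEquivZMod p K).symm

/-- `σ_{a⁻¹} = σ_a⁻¹`. [folklore] -/
theorem gal_inv (a : (ZMod p)ˣ) : gal p K a⁻¹ = (gal p K a)⁻¹ := map_inv (Rat.galEquivZMod p K).symm a

/-- `σ_a` acts on the values of a character `φ` with `φ^p = 1` (so `φ(x) ∈ μ_p ∪ {0}`) by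
`φ(x) ↦ φ(x)^a = φ^a(x)` [Schoof2009, Exercise 9.6 (b): `σ_a(τ(χ)) = τ(χ^a)`].
[cite: Schoof2009, Exercise 9.6 (b)] -/
theorem gal_smul_apply {φ : MulChar (ZMod l) (𝓞 K)} (hφ : φ ^ p = 1) (a : (ZMod p)ˣ) (x : ZMod l) :
    gal p K a • φ x = (φ ^ (a : ZMod p).val) x := by
  have ha : (a : ZMod p).val ≠ 0 := by
    rw [Ne, ZMod.val_eq_zero]; exact a.ne_zero
  rw [MulChar.pow_apply' _ ha]
  by_cases hx : IsUnit x
  · apply gal_smul_of_pow_eq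
    rw [← MulChar.pow_apply' _ hp.out.ne_zero, hφ, MulChar.one_apply hx]
  · rw [MulChar.map_nonunit _ hx, smul_zero, zero_pow ha]

/-- `σ_a J(φ, ψ) = J(φ^a, ψ^a)` for characters with `φ^p = ψ^p = 1` (Jacobi sums `J(φ,ψ) = ∑ φ(x) ψ(1-x)`
lie in `ℤ[μ_p] ⊆ 𝓞 K`). [cite: Schoof2009, Exercise 9.6 (b)] -/
theorem gal_smul_jacobiSum {φ ψ : MulChar (ZMod l) (𝓞 K)} (hφ : φ ^ p = 1) (hψ : ψ ^ p = 1)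
    (a : (ZMod p)ˣ) :
    gal p K a • jacobiSum φ ψ = jacobiSum (φ ^ (a : ZMod p).val) (ψ ^ (a : ZMod p).val) := by
  unfold jacobiSum
  rw [Finset.smul_sum]
  apply Finset.sum_congr rfl
  intro x _
  rw [smul_mul', gal_smul_apply hφ, gal_smul_apply hψ]

/-- Galois automorphisms fix natural numbers. [folklore] -/
theorem gal_smul_natCast (σ : Gal(K/ℚ)) (n : ℕ) : σ • (n : 𝓞 K) = n :=
  map_natCast (MulSemiringAction.toRingHom _ (𝓞 K) σ) n

/-- `D_b(φ) = ∏_{1 ≤ j < b} J(φ, φ^j) ∈ 𝓞 K`, the product of Jacobi sums with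
`τ(φ)^b = τ(φ^b) D_b(φ)` (`0 < b < ord φ`). [cite: Schoof2009, Theorem 9.5 (proof)] -/
noncomputable def jacProd (φ : MulChar (ZMod l) (𝓞 K)) (b : ℕ) : 𝓞 K :=
  ∏ j ∈ Ico 1 b, jacobiSum φ (φ ^ j)

/-- `g(φ) = φ(-1) · l · ∏_{1 ≤ j ≤ ord φ - 2} J(φ, φ^j) ∈ 𝓞 K`; for `φ` of order `p` this is `τ(φ)^p`
(`tau_pow_orderOf`), the element whose ideal factorisation is `𝔩^{θ_p}` up to conjugation
[Schoof2009, proof of Theorem 9.5: "`(τ^p) = ∏ σ_a⁻¹(𝔩)^{x_a}`"]. [cite: Schoof2009, Theorem 9.5 (proof)] -/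
noncomputable def gElt (φ : MulChar (ZMod l) (𝓞 K)) : 𝓞 K :=
  φ (-1) * l * jacProd φ (orderOf φ - 1)

section BigRing

/-! ### The auxiliary ring `𝓞 K(ζ_l)` and the Gauss sums -/

variable (K l) in
/-- The auxiliary field `M = K(ζ_l)`. [cite: Schoof2009, Theorem 9.5 (proof: "`F(ζ_l)`")] -/
abbrev M : Type _ := CyclotomicField l K

/-- `M = K(ζ_l)` is a number field. [folklore] -/
instance : NumberField (M K l) := IsCyclotomicExtension.numberField {l} K _

variable (K l) in
/-- `ξ = ζ_l`, a primitive `l`-th root of unity in `𝓞 M`. [cite: Schoof2009, Theorem 9.5 (proof)] -/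
noncomputable def xi : 𝓞 (M K l) := (zeta_spec l K (M K l)).toInteger

/-- `ξ` is a primitive `l`-th root of unity. [folklore] -/
theorem xi_spec : IsPrimitiveRoot (xi K l) l := (zeta_spec l K (M K l)).toInteger_isPrimitiveRoot

variable (K l) in
/-- The additive character `x ↦ ξ^x` of `ℤ/lℤ` with values in `𝓞 M`. [cite: Schoof2009, Theorem 9.5 (proof)] -/
noncomputable def psi : AddChar (ZMod l) (𝓞 (M K l)) :=
  AddChar.zmodChar l (xi_spec (K := K) (l := l)).pow_eq_one

/-- `x ↦ ξ^x` is a primitive additive character (`ξ` is a primitive `l`-th root of unity). [folklore] -/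
theorem psi_prim : (psi K l).IsPrimitive := by
  have := AddChar.zmodChar_primitive_of_primitive_root l (xi_spec (K := K) (l := l))
  exact this

variable (K l) in
/-- The structure map `𝓞 K → 𝓞 M`. [folklore] -/
noncomputable abbrev toM : 𝓞 K →+* 𝓞 (M K l) := algebraMap (𝓞 K) (𝓞 (M K l))

omit [NumberField K] hl in
/-- `𝓞 K → 𝓞 M` is injective. [folklore] -/
theorem toM_injective : Function.Injective (toM K l) := by
  intro x y h
  have h1 : algebraMap (𝓞 (M K l)) (M K l) (toM K l x) = algebraMap (𝓞 (M K l)) (M K l) (toM K l y) := by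
    rw [h]
  rw [toM, ← IsScalarTower.algebraMap_apply, ← IsScalarTower.algebraMap_apply,
    IsScalarTower.algebraMap_apply (𝓞 K) K (M K l),
    IsScalarTower.algebraMap_apply (𝓞 K) K (M K l)] at h1
  exact FaithfulSMul.algebraMap_injective (𝓞 K) K ((algebraMap K (M K l)).injective h1)

/-- **The Gauss sum** `τ(φ) = ∑_{x ∈ ℤ/lℤ} φ(x) ξ^x ∈ 𝓞 M` (Mathlib's `gaussSum`; Schoof's `τ` is `-τ(φ)`,
the sign is immaterial for `p`-th powers of ideals). [cite: Schoof2009, Theorem 9.5 (proof, p. 63)] -/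
noncomputable def tau (φ : MulChar (ZMod l) (𝓞 K)) : 𝓞 (M K l) :=
  gaussSum (φ.ringHomComp (toM K l)) (psi K l)

omit [NumberField K] hl in
/-- Transporting `φ` along the injection `𝓞 K → 𝓞 M` preserves its order. [folklore] -/
theorem orderOf_ringHomComp (φ : MulChar (ZMod l) (𝓞 K)) :
    orderOf (φ.ringHomComp (toM K l)) = orderOf φ := by
  have : φ.ringHomComp (toM K l) = MulChar.ringHomCompHom (toM K l) φ := rfl
  rw [this]
  exact orderOf_injective _ (MulChar.injective_ringHomComp toM_injective) φ

/-- `τ(φ)^{ord φ} = g(φ)`: Mathlib's `gaussSum_pow_eq_prod_jacobiSum`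
(`τ^n = φ(-1) · l · ∏_{j=1}^{n-2} J(φ, φ^j)`), transported to `𝓞 K`. In particular `τ^p ∈ 𝓞 K`
[Schoof2009, p. 63: "`τ^p` is `Δ`-invariant and is hence contained in `F`"]. [cite: Schoof2009, Theorem 9.5 (proof, p. 63)] -/
theorem tau_pow_orderOf {φ : MulChar (ZMod l) (𝓞 K)} (hφ : 2 ≤ orderOf φ) :
    tau φ ^ orderOf φ = toM K l (gElt φ) := by
  have h := gaussSum_pow_eq_prod_jacobiSum (χ := φ.ringHomComp (toM K l)) (ψ := psi K l)
    (by rwa [orderOf_ringHomComp]) psi_prim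
  rw [orderOf_ringHomComp] at h
  rw [tau, h, gElt, jacProd, map_mul, map_mul, map_prod, map_natCast, ZMod.card]
  congr 1
  apply Finset.prod_congr rfl
  intro j _
  rw [← jacobiSum_ringHomComp, MulChar.ringHomComp_pow]

/-- `τ(φ)^b = τ(φ^b) · D_b(φ)` for `0 < b < ord φ` (Mathlib's `gaussSum_pow_eq_prod_jacobiSum_aux`). [folklore] -/
theorem tau_pow {φ : MulChar (ZMod l) (𝓞 K)} {b : ℕ} (hb0 : 0 < b) (hb : b < orderOf φ) :
    tau φ ^ b = tau (φ ^ b) * toM K l (jacProd φ b) := by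
  have h := gaussSum_pow_eq_prod_jacobiSum_aux (φ.ringHomComp (toM K l)) (psi K l) hb0
    (by rwa [orderOf_ringHomComp])
  rw [tau, h, tau, jacProd, map_prod, MulChar.ringHomComp_pow]
  congr 1
  apply Finset.prod_congr rfl
  intro j _
  rw [← jacobiSum_ringHomComp, MulChar.ringHomComp_pow]

omit [NumberField K] hK hl in
/-- `φ^b` has order `p` again for `0 < b < p = ord φ`. [folklore] -/
theorem orderOf_pow_of_lt {φ : MulChar (ZMod l) (𝓞 K)} (hφ : orderOf φ = p) {b : ℕ} (hb0 : 0 < b)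
    (hb : b < p) : orderOf (φ ^ b) = p := by
  rw [orderOf_pow' φ hb0.ne', hφ]
  have : Nat.gcd p b = 1 := Nat.coprime_of_lt_prime hb0.ne' hb hp.out
  rw [this, Nat.div_one]

omit hK in
/-- **`g(φ)^b = g(φ^b) · D_b(φ)^p`** for `0 < b < p = ord φ`: our replacement for
"`σ_b(τ^p) = τ^{pb} · (p`-th power`)`" [Schoof2009, p. 63] (with `gal_smul_gElt`: `g(φ^b) = σ_b g(φ)`).
[cite: Schoof2009, Theorem 9.5 (proof, p. 63)] -/
theorem gElt_pow {φ : MulChar (ZMod l) (𝓞 K)} (hφ : orderOf φ = p) {b : ℕ} (hb0 : 0 < b)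
    (hb : b < p) : gElt φ ^ b = gElt (φ ^ b) * jacProd φ b ^ p := by
  apply toM_injective (l := l)
  have h2 : 2 ≤ orderOf φ := by rw [hφ]; exact hp.out.two_le
  have h2' : 2 ≤ orderOf (φ ^ b) := by rw [orderOf_pow_of_lt hφ hb0 hb]; exact hp.out.two_le
  have e1 := tau_pow_orderOf h2
  have e2 := tau_pow_orderOf h2'
  rw [hφ] at e1
  rw [orderOf_pow_of_lt hφ hb0 hb] at e2
  rw [map_pow, map_mul, map_pow, ← e1, ← e2, ← pow_mul, mul_comm p b, pow_mul,
    tau_pow hb0 (by rwa [hφ]), mul_pow]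

omit [NumberField K] hK in
/-- A character of odd order `p` has `φ(-1) = 1` (`φ(-1)² = 1 = φ(-1)^p`). [folklore] -/
theorem apply_neg_one {φ : MulChar (ZMod l) (𝓞 K)} (hφ : orderOf φ = p) (hp2 : p ≠ 2) :
    φ (-1) = 1 := by
  have h1 : φ (-1) ^ 2 = 1 := by
    rw [sq, ← map_mul, neg_one_mul, neg_neg, map_one]
  have h2 : φ (-1) ^ p = 1 := by
    have : (φ ^ p) (-1) = 1 := by rw [← hφ, pow_orderOf_eq_one, MulChar.one_apply isUnit_one.neg]
    rwa [MulChar.pow_apply' _ hp.out.ne_zero] at this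
  obtain ⟨k, hk⟩ := hp.out.eq_two_or_odd'.resolve_left hp2
  rw [hk, pow_succ, pow_mul, h1, one_pow, one_mul] at h2
  exact h2

omit hK in
/-- **`g(φ) · g(φ⁻¹) = l^p`**, from `τ(φ) τ(φ⁻¹) = l` [Schoof2009, Exercise 9.6 (a)] (Mathlib's
`gaussSum_mul_gaussSum_eq_card`). [cite: Schoof2009, Exercise 9.6 (a)] -/
theorem gElt_mul_gElt_inv {φ : MulChar (ZMod l) (𝓞 K)} (hφ : orderOf φ = p) (hp2 : p ≠ 2) :
    gElt φ * gElt φ⁻¹ = (l : 𝓞 K) ^ p := by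
  apply toM_injective (l := l)
  have hφ1 : φ ≠ 1 := by
    intro h; rw [h, orderOf_one] at hφ; exact hp.out.one_lt.ne' hφ.symm
  have hφ' : orderOf φ⁻¹ = p := by rw [orderOf_inv, hφ]
  have h2 : 2 ≤ orderOf φ := by rw [hφ]; exact hp.out.two_le
  have h2' : 2 ≤ orderOf φ⁻¹ := by rw [hφ']; exact hp.out.two_le
  have e1 := tau_pow_orderOf h2
  have e2 := tau_pow_orderOf h2'
  rw [hφ] at e1
  rw [hφ'] at e2
  rw [map_mul, ← e1, ← e2, map_pow, map_natCast, ← mul_pow]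
  congr 1
  -- `τ(φ) τ(φ⁻¹) = l`
  have key := gaussSum_mul_gaussSum_eq_card (χ := φ.ringHomComp (toM K l)) (ψ := psi K l)
    ((MulChar.ringHomComp_ne_one_iff toM_injective).mpr hφ1) psi_prim
  rw [ZMod.card] at key
  rw [← key, tau, tau]
  congr 1
  have h3 := mul_gaussSum_inv_eq_gaussSum (φ.ringHomComp (toM K l))⁻¹ (psi K l)⁻¹
  rw [inv_inv] at h3
  rw [← MulChar.ringHomComp_inv, ← h3, MulChar.inv_apply', inv_neg_one, MulChar.ringHomComp_apply,
    apply_neg_one hφ hp2, map_one, one_mul]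

/-- `τ(φ) ∈ (ξ - 1) 𝓞 M` for `φ ≠ 1`: `τ(φ) = ∑ φ(x) (ξ^x - 1)` as `∑ φ(x) = 0`. [folklore] -/
theorem tau_mem_span {φ : MulChar (ZMod l) (𝓞 K)} (hφ1 : φ ≠ 1) :
    tau φ ∈ Ideal.span {xi K l - 1} := by
  have hsum : ∑ x : ZMod l, (φ.ringHomComp (toM K l)) x = 0 :=
    MulChar.sum_eq_zero_of_ne_one ((MulChar.ringHomComp_ne_one_iff toM_injective).mpr hφ1)
  have e : tau φ = ∑ x : ZMod l, (φ.ringHomComp (toM K l)) x * (psi K l x - 1) := by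
    rw [tau, gaussSum]
    simp only [mul_sub, mul_one, Finset.sum_sub_distrib, hsum, sub_zero]
  rw [e]
  apply Ideal.sum_mem
  intro x _
  apply Ideal.mul_mem_left
  rw [psi, AddChar.zmodChar_apply, Ideal.mem_span_singleton]
  exact sub_one_dvd_pow_sub_one _ _

/-- `ξ - 1` lies in every prime ideal of `𝓞 M` containing `l` (since `l = Φ_l(1) = ∏ (1 - ξ^k)` over the
primitive `l`-th roots of unity). [folklore] -/
theorem xi_sub_one_mem {Q : Ideal (𝓞 (M K l))} [hQ : Q.IsPrime] (hlQ : (l : 𝓞 (M K l)) ∈ Q) :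
    xi K l - 1 ∈ Q := by
  have h1 : (cyclotomic l (𝓞 (M K l))).eval 1 = (l : 𝓞 (M K l)) := eval_one_cyclotomic_prime
  rw [cyclotomic_eq_prod_X_sub_primitiveRoots xi_spec, eval_prod] at h1
  simp only [eval_sub, eval_X, eval_C] at h1
  rw [← h1] at hlQ
  obtain ⟨μ, hμ, hμQ⟩ := Ideal.IsPrime.prod_mem_iff.mp hlQ
  rw [mem_primitiveRoots hl.out.pos] at hμ
  obtain ⟨k, -, hk⟩ := hμ.eq_pow_of_pow_eq_one xi_spec.pow_eq_one
  rw [← hk]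
  obtain ⟨c, hc⟩ : μ - 1 ∣ μ ^ k - 1 := sub_one_dvd_pow_sub_one _ _
  have h2 : μ - 1 ∈ Q := by
    have : -(1 - μ) ∈ Q := Q.neg_mem_iff.mpr hμQ
    rwa [neg_sub] at this
  rw [hc]
  exact Q.mul_mem_right c h2

omit hK in
/-- **`g(φ)` lies in every prime of `𝓞 K` above `l`** (for `φ` of order `p`): choose a prime `Q` of `𝓞 M`
above the given prime `P` (going up); `τ(φ) ∈ (ξ - 1) ⊆ Q`, so `g(φ) = τ(φ)^p ∈ Q ∩ 𝓞 K = P`. This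
replaces the ramification argument "`x_1 ≢ 0 (mod p)`" of [Schoof2009, p. 64]: every exponent `x_a`
in `(τ^p) = ∏ σ_a⁻¹(𝔩)^{x_a}` is `≥ 1`. [cite: Schoof2009, Theorem 9.5 (proof, p. 64)] -/
theorem gElt_mem {φ : MulChar (ZMod l) (𝓞 K)} (hφ : orderOf φ = p) (P : Ideal (𝓞 K))
    [hP : P.IsPrime] (hlP : (l : 𝓞 K) ∈ P) : gElt φ ∈ P := by
  have hφ1 : φ ≠ 1 := by
    intro h; rw [h, orderOf_one] at hφ; exact hp.out.one_lt.ne' hφ.symm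
  obtain ⟨Q, -, hQ, hQP⟩ := Ideal.exists_ideal_over_prime_of_isIntegral (S := 𝓞 (M K l)) P ⊥
    (by rw [Ideal.comap_bot_of_injective _ toM_injective]; exact bot_le)
  have hlQ : (l : 𝓞 (M K l)) ∈ Q := by
    have : toM K l l ∈ Q := by rw [← Ideal.mem_comap, hQP]; exact hlP
    rwa [map_natCast] at this
  have h1 : tau φ ∈ Q :=
    (Ideal.span_singleton_le_iff_mem _).mpr (xi_sub_one_mem hlQ) (tau_mem_span hφ1)
  have h2 : tau φ ^ p ∈ Q := Q.pow_mem_of_mem h1 p hp.out.pos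
  have h3 : 2 ≤ orderOf φ := by rw [hφ]; exact hp.out.two_le
  rw [← hφ, tau_pow_orderOf h3] at h2
  rw [← hQP, Ideal.mem_comap]
  exact h2

end BigRing

omit hp [NumberField K] hK hl in
/-- `φ^p = 1` for `φ` of order `p`. [folklore] -/
theorem pow_orderOf_eq_one' {φ : MulChar (ZMod l) (𝓞 K)} (hφ : orderOf φ = p) : φ ^ p = 1 := by
  rw [← hφ, pow_orderOf_eq_one]

/-- **`σ_a g(φ) = g(φ^a)`** (coefficientwise action of `σ_a` on Jacobi sums, `φ(-1) = 1`).
[cite: Schoof2009, Exercise 9.6 (b)] -/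
theorem gal_smul_gElt {φ : MulChar (ZMod l) (𝓞 K)} (hφ : orderOf φ = p) (a : (ZMod p)ˣ) :
    gal p K a • gElt φ = gElt (φ ^ (a : ZMod p).val) := by
  have hφp := pow_orderOf_eq_one' hφ
  have ha0 : 0 < (a : ZMod p).val := by
    rw [Nat.pos_iff_ne_zero, Ne, ZMod.val_eq_zero]; exact a.ne_zero
  have hφa : orderOf (φ ^ (a : ZMod p).val) = p := orderOf_pow_of_lt hφ ha0 (ZMod.val_lt _)
  rw [gElt, gElt, hφ, hφa, smul_mul', smul_mul', gal_smul_natCast, gal_smul_apply hφp, jacProd,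
    jacProd, Finset.smul_prod']
  congr 1
  apply Finset.prod_congr rfl
  intro j _
  rw [gal_smul_jacobiSum hφp (by rw [← pow_mul, mul_comm, pow_mul, hφp, one_pow]), ← pow_mul,
    ← pow_mul, mul_comm]

/-- `σ_a D_b(φ) = D_b(φ^a)`. [cite: Schoof2009, Exercise 9.6 (b)] -/
theorem gal_smul_jacProd {φ : MulChar (ZMod l) (𝓞 K)} (hφ : orderOf φ = p) (a : (ZMod p)ˣ) (b : ℕ) :
    gal p K a • jacProd φ b = jacProd (φ ^ (a : ZMod p).val) b := by
  have hφp := pow_orderOf_eq_one' hφ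
  rw [jacProd, jacProd, Finset.smul_prod']
  apply Finset.prod_congr rfl
  intro j _
  rw [gal_smul_jacobiSum hφp (by rw [← pow_mul, mul_comm, pow_mul, hφp, one_pow]), ← pow_mul,
    ← pow_mul, mul_comm]

end Stickelberger

end Literature.NumberTheory.NumberFields
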